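import Summits.MatrixMultiplication.MatrixMultiplication.Theorems.FarEdgeDescentSmoothCut
import Literature.Computability.AlgebraicComplexity.RectangularExponentProofs
import Mathlib.Analysis.Convex.Deriv
import Mathlib.Analysis.Convex.Continuous
import HarnessLib

/-!
# Route `FarEdgeDescent` — the CONTACT TRICHOTOMY of the far-edge profile, I: convex analysis and exhaustion

Support module (def-free) for the asides `SmoothProfile` (stmt-MatrixMultiplication-27850) and `TameProfile`
(stmt-MatrixMultiplication-31917) and the special crux `FiniteSaturation` (stmt-MatrixMultiplication-23739) of
`Summits/MatrixMultiplication/MatrixMultiplication/Theses/FarEdgeDescent.lean`.  The cut of record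
`ω(ℂ) = 2 ⟺ FiniteSaturation ∧ AnchoredLogConvexity` (`FarEdgeDescentChord.node_iff`) and its deciding theorem
`closes` are unchanged.  Part II is `FarEdgeDescentContactAtoms` (exactness of the regularity leaf; classification
of the lineage's leaves by excluded atoms).

Write `f(x) = ω(1,x,1)` (tree `omegaRect ℂ 1 x 1`) and `e(x) = f(x) − (x+1) ≥ 0` (Huang–Pan).  The one input
beyond the landed far-edge kernels is the tree's PROVED convexity of the true profile
(`omegaRect_convexOn_one_mid_one`, Lotti–Romani 1983, Prop. 4.1), used through Mathlib's one-sided-derivative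
API for convex functions (`ConvexOn.hasDerivWithinAt_leftDeriv_of_mem_interior`,
`ConvexOn.slope_le_leftDeriv_of_mem_interior`, `ConvexOn.continuousOn_interior`; Rockafellar, Thm. 24.1).

* §1 CONVEX ANALYSIS OF THE TRUE PROFILE.  `f` is continuous on `(0,∞)`; at every shape `b > 0` the left
  derivative `∂⁻f(b) := derivWithin f (Iio b) b` exists and supports `f` from below on `[0,b)`
  (`sub_leftDeriv_mul_le`); at a SATURATED shape `b > 1` (`f b = b+1`): `∂⁻f(b) ≤ 1` (`leftDeriv_le_one`),
  `∂⁻f(b) ≥ 1 − (ω−2)/(b−1)` (`one_sub_le_leftDeriv`), the right derivative is `1` (`hasDerivWithinAt_right_one`),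
  and `f` is differentiable at `b` IFF `∂⁻f(b) = 1` (`differentiableAt_iff_leftDeriv_eq_one`).
* §2 CONTACTS.  A transversal contact (`TC`, the gen-21 shape `∃ b > 1, a < 1: f = y+1 on [b,∞), f ≥ f(b) − a(b−·)
  on [1,b]`) sits at the FIRST ZERO of `e` (`firstZero_of_transversal`); first zeros are unique
  (`firstZero_unique`); under `FiniteSaturation ∧ ω > 2` the first zero `β > 1` EXISTS (`exists_firstZero`: the
  zero set of `e` on `[1,∞)` is a closed up-ray — up-set by `excess_antitone`, closed by continuity).  LOCAL
  DICHOTOMY at a saturated `b > 1`: `f` differentiable at `b` ⟺ no transversal contact at `b`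
  (`differentiableAt_iff_not_transversalAt`), the gap case `∂⁻f(b) < 1` being a transversal contact of slope
  `∂⁻f(b)` (`transversalAt_of_leftDeriv_lt_one`).  CONTACT-ANGLE PRICE `(1−a)(b−1) ≤ ω − 2`
  (`contact_angle_price`); in a tangential contact `e(x) = o(x − b)` (`excess_isLittleO_of_tangential`).
* §3 ★ THE CONTACT TRICHOTOMY (hypothesis-free exhaustion, `not_mm_iff_round_or_transversal_or_tangential`):
  `ω(ℂ) > 2` iff EXACTLY ONE of
  (W1) ROUND — `¬FiniteSaturation` (`e > 0` on `[1,∞)`);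
  (W2) TRANSVERSAL — `TC` (the excess dies at `β` with a corner: contact angle `κ = 1 − ∂⁻f(β) > 0`);
  (W3) TANGENTIAL — a first zero `β > 1` at which `f` is differentiable (`κ = 0`).
  Pairwise exclusive (`round_transversal_exclusive`, `round_tangential_exclusive`,
  `transversal_tangential_exclusive`); each world forces `ω > 2` (`not_mm_of_tangential`, landed
  `not_mm_of_transversal`).

Placement [cite: LottiRomani1983, Prop. 4.1 (convexity of ω(1,k,1)), §5] [cite: HuangPan1998, (2.8), §8.3]
[cite: AlmanLiPratt2026, §8 (ω(1,k,1) − k − 1 → 0 and its O(1/log k) rate)] [cite: Rockafellar1970, Thm. 24.1].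
Written by the decomp-mm lens-2 planner seat (gen 22); imports only BUILT modules; no new definitions.
-/

set_option linter.dupNamespace false

noncomputable section

namespace Summit.MatrixMultiplication.MatrixMultiplication.Theorems.FarEdgeDescentContactTrichotomy

open Literature.Computability.AlgebraicComplexity
open Summit.MatrixMultiplication.MatrixMultiplication.Theses.FarEdgeDescent
open Summit.MatrixMultiplication.MatrixMultiplication.Theorems.FarEdgeDescentChord
open Summit.MatrixMultiplication.MatrixMultiplication.Theorems.FarEdgeDescentTameProfile
open Summit.MatrixMultiplication.MatrixMultiplication.Theorems.FarEdgeDescentSmoothCut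
open Filter Topology Set Asymptotics

/-! ## §1 Convex analysis of the true profile `f(x) = ω(1,x,1)` -/

/-- The far-edge profile is convex on `[0, ∞)` (Lotti–Romani 1983, Prop. 4.1; tree
`omegaRect_convexOn_one_mid_one`). -/
theorem profile_convexOn : ConvexOn ℝ (Ici (0 : ℝ)) (fun y : ℝ => omegaRect ℂ 1 y 1) :=
  omegaRect_convexOn_one_mid_one ℂ

/-- Positive shapes are interior points of the convexity domain. -/
theorem mem_interior_Ici {b : ℝ} (hb : 0 < b) : b ∈ interior (Ici (0 : ℝ)) := by
  rw [interior_Ici]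
  exact hb

/-- The profile is continuous at every shape `b > 0` (a finite convex function is continuous on the interior
of its domain). -/
theorem profile_continuousAt {b : ℝ} (hb : 0 < b) :
    ContinuousAt (fun y : ℝ => omegaRect ℂ 1 y 1) b := by
  have h := profile_convexOn.continuousOn_interior
  rw [interior_Ici] at h
  exact h.continuousAt (Ioi_mem_nhds hb)

/-- Saturation propagates to the right: `f b = b + 1 → b ≤ y → f y = y + 1` (`excess_antitone` and the
Huang–Pan bound `f ≥ y + 1`). -/
theorem saturated_of_le {b y : ℝ} (hb : omegaRect ℂ 1 b 1 = b + 1) (hy : b ≤ y) :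
    omegaRect ℂ 1 y 1 = y + 1 := by
  have h1 := excess_antitone (x := y) (y := b) hy
  have h0 := add_one_le_omegaRect_one_mid_one ℂ y
  linarith

/-- The LEFT DERIVATIVE `∂⁻f(b) := derivWithin f (Iio b) b` exists at every shape `b > 0`. -/
theorem hasDerivWithinAt_left {b : ℝ} (hb : 0 < b) :
    HasDerivWithinAt (fun y : ℝ => omegaRect ℂ 1 y 1)
      (derivWithin (fun y : ℝ => omegaRect ℂ 1 y 1) (Iio b) b) (Iio b) b :=
  profile_convexOn.hasDerivWithinAt_leftDeriv_of_mem_interior (mem_interior_Ici hb)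

/-- The left derivative supports the profile from below on the left: for `0 ≤ x < b`,
`f b − ∂⁻f(b)·(b − x) ≤ f x` (secant slopes into `b` are `≤ ∂⁻f(b)`). -/
theorem sub_leftDeriv_mul_le {b x : ℝ} (hb : 0 < b) (hx : 0 ≤ x) (hxb : x < b) :
    omegaRect ℂ 1 b 1 - derivWithin (fun y : ℝ => omegaRect ℂ 1 y 1) (Iio b) b * (b - x) ≤
      omegaRect ℂ 1 x 1 := by
  have h := profile_convexOn.slope_le_leftDeriv_of_mem_interior (x := x) (y := b) (mem_Ici.2 hx)
    (mem_interior_Ici hb) hxb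
  rw [slope_def_field, div_le_iff₀ (sub_pos.2 hxb)] at h
  linarith

/-- At a SATURATED shape `b > 1` the left derivative is at most `1` (left secants from `[1,b)` have slope `≤ 1`
because `f x ≥ x + 1 = f b − (b − x)`). -/
theorem leftDeriv_le_one {b : ℝ} (hb : 1 < b) (hs : omegaRect ℂ 1 b 1 = b + 1) :
    derivWithin (fun y : ℝ => omegaRect ℂ 1 y 1) (Iio b) b ≤ 1 := by
  have h := (hasDerivWithinAt_iff_tendsto_slope' self_notMem_Iio).1
    (hasDerivWithinAt_left (b := b) (by linarith))
  refine le_of_tendsto h ?_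
  filter_upwards [Ioo_mem_nhdsLT hb] with x hx
  rw [slope_def_field, div_le_iff_of_neg (by linarith [hx.2])]
  have h1 := add_one_le_omegaRect_one_mid_one ℂ x
  simp only [hs]
  linarith

/-- At a saturated shape `b > 1` the left derivative is at least the secant slope from the square shape:
`1 − (ω − 2)/(b − 1) ≤ ∂⁻f(b)`; i.e. the CONTACT ANGLE `κ = 1 − ∂⁻f(b)` is at most `e(1)/(b−1)`. -/
theorem one_sub_le_leftDeriv {b : ℝ} (hb : 1 < b) (hs : omegaRect ℂ 1 b 1 = b + 1) :
    1 - (omega ℂ - 2) / (b - 1) ≤ derivWithin (fun y : ℝ => omegaRect ℂ 1 y 1) (Iio b) b := by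
  have h := sub_leftDeriv_mul_le (b := b) (x := 1) (by linarith) zero_le_one hb
  rw [omegaRect_one_one_one, hs] at h
  have hb1 : 0 < b - 1 := sub_pos.2 hb
  rw [sub_le_comm, le_div_iff₀ hb1]
  have e : (1 - derivWithin (fun y : ℝ => omegaRect ℂ 1 y 1) (Iio b) b) * (b - 1) =
      (b - 1) - derivWithin (fun y : ℝ => omegaRect ℂ 1 y 1) (Iio b) b * (b - 1) := by ring
  rw [e]
  linarith

/-- At a saturated shape `b` the RIGHT derivative is `1`: `f = y + 1` on `[b, ∞)`. -/
theorem hasDerivWithinAt_right_one {b : ℝ} (hs : omegaRect ℂ 1 b 1 = b + 1) :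
    HasDerivWithinAt (fun y : ℝ => omegaRect ℂ 1 y 1) 1 (Ioi b) b := by
  have h1 : HasDerivWithinAt (fun y : ℝ => y + 1) 1 (Ioi b) b :=
    ((hasDerivAt_id b).add_const 1).hasDerivWithinAt
  refine h1.congr_of_eventuallyEq ?_ ?_
  · filter_upwards [self_mem_nhdsWithin] with y hy
    exact saturated_of_le hs (le_of_lt hy)
  · simpa using hs

/-- If `f` is differentiable at a saturated shape `b`, its derivative there is `1`. -/
theorem hasDerivAt_one_of_differentiableAt {b : ℝ} (hs : omegaRect ℂ 1 b 1 = b + 1)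
    (hd : DifferentiableAt ℝ (fun y : ℝ => omegaRect ℂ 1 y 1) b) :
    HasDerivAt (fun y : ℝ => omegaRect ℂ 1 y 1) 1 b := by
  have h := hd.hasDerivAt
  have e1 : deriv (fun y : ℝ => omegaRect ℂ 1 y 1) b = 1 :=
    UniqueDiffWithinAt.eq_deriv _ (uniqueDiffWithinAt_Ioi b) h.hasDerivWithinAt
      (hasDerivWithinAt_right_one hs)
  rwa [e1] at h

/-- ★ **Differentiability criterion at a saturated shape.**  At a saturated `b > 1`, `f` is differentiable at
`b` iff its left derivative there equals `1` (the right derivative being `1`). -/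
theorem differentiableAt_iff_leftDeriv_eq_one {b : ℝ} (hb : 1 < b) (hs : omegaRect ℂ 1 b 1 = b + 1) :
    DifferentiableAt ℝ (fun y : ℝ => omegaRect ℂ 1 y 1) b ↔
      derivWithin (fun y : ℝ => omegaRect ℂ 1 y 1) (Iio b) b = 1 := by
  constructor
  · intro hd
    exact UniqueDiffWithinAt.eq_deriv _ (uniqueDiffWithinAt_Iio b) (hasDerivWithinAt_left (by linarith))
      (hasDerivAt_one_of_differentiableAt hs hd).hasDerivWithinAt
  · intro hL
    have hl := hasDerivWithinAt_left (b := b) (by linarith)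
    rw [hL] at hl
    have h : HasDerivAt (fun y : ℝ => omegaRect ℂ 1 y 1) 1 b := by
      rw [hasDerivAt_iff_tendsto_slope, ← nhdsLT_sup_nhdsGT]
      exact ((hasDerivWithinAt_iff_tendsto_slope' self_notMem_Iio).1 hl).sup
        ((hasDerivWithinAt_iff_tendsto_slope' self_notMem_Ioi).1 (hasDerivWithinAt_right_one hs))
    exact h.differentiableAt

/-! ## §2 Contacts: first zero, transversal and tangential contact, the contact-angle price -/

/-- A TRANSVERSAL CONTACT shape is the FIRST ZERO of the excess: `f b = b + 1` and `f x > x + 1` on `[1, b)`. -/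
theorem firstZero_of_transversal {b a : ℝ} (ha : a < 1)
    (hright : ∀ y : ℝ, b ≤ y → omegaRect ℂ 1 y 1 = y + 1)
    (hleft : ∀ x : ℝ, 1 ≤ x → x ≤ b → omegaRect ℂ 1 b 1 - a * (b - x) ≤ omegaRect ℂ 1 x 1) :
    omegaRect ℂ 1 b 1 = b + 1 ∧ ∀ x : ℝ, 1 ≤ x → x < b → x + 1 < omegaRect ℂ 1 x 1 := by
  refine ⟨hright b le_rfl, fun x hx hxb => ?_⟩
  have h1 := hleft x hx hxb.le
  rw [hright b le_rfl] at h1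
  nlinarith [mul_pos (sub_pos.2 ha) (sub_pos.2 hxb)]

/-- First zeros of the excess (on `[1,∞)`) are unique. -/
theorem firstZero_unique {b b' : ℝ} (hb1 : 1 ≤ b) (hb1' : 1 ≤ b')
    (hb : omegaRect ℂ 1 b 1 = b + 1 ∧ ∀ x : ℝ, 1 ≤ x → x < b → x + 1 < omegaRect ℂ 1 x 1)
    (hb' : omegaRect ℂ 1 b' 1 = b' + 1 ∧ ∀ x : ℝ, 1 ≤ x → x < b' → x + 1 < omegaRect ℂ 1 x 1) :
    b = b' := by
  by_contra hne
  rcases lt_or_gt_of_ne hne with h | h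
  · have := hb'.2 b hb1 h
    linarith [hb.1]
  · have := hb.2 b' hb1' h
    linarith [hb'.1]

/-- ★ **Existence of the first zero.**  Under `FiniteSaturation` and `ω > 2` the excess has a first zero
`β > 1`: `f β = β + 1` and `f x > x + 1` on `[1, β)`.  (The zero set of `e` on `[1,∞)` is a non-empty up-set by
`excess_antitone`; its infimum `β` is a zero by CONTINUITY of the convex profile; `β > 1` because `e(1) = ω − 2 > 0`.) -/
theorem exists_firstZero (hF : FiniteSaturation) (hS : ¬ _root_.MatrixMultiplication) :
    ∃ b : ℝ, 1 < b ∧ omegaRect ℂ 1 b 1 = b + 1 ∧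
      ∀ x : ℝ, 1 ≤ x → x < b → x + 1 < omegaRect ℂ 1 x 1 := by
  obtain ⟨k, hk, hsk⟩ := finiteSaturation_iff_realSaturation.1 hF
  have hkZ : k ∈ {x : ℝ | 1 ≤ x ∧ omegaRect ℂ 1 x 1 = x + 1} := ⟨hk.le, hsk⟩
  have hne : ({x : ℝ | 1 ≤ x ∧ omegaRect ℂ 1 x 1 = x + 1} : Set ℝ).Nonempty := ⟨k, hkZ⟩
  have hlow : ∀ x ∈ ({x : ℝ | 1 ≤ x ∧ omegaRect ℂ 1 x 1 = x + 1} : Set ℝ), (1 : ℝ) ≤ x :=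
    fun x hx => hx.1
  have hbdd : BddBelow ({x : ℝ | 1 ≤ x ∧ omegaRect ℂ 1 x 1 = x + 1} : Set ℝ) := ⟨1, hlow⟩
  -- name the infimum
  obtain ⟨β, hβ⟩ : ∃ β : ℝ, β = sInf {x : ℝ | 1 ≤ x ∧ omegaRect ℂ 1 x 1 = x + 1} := ⟨_, rfl⟩
  have hβ1 : 1 ≤ β := hβ ▸ le_csInf hne hlow
  -- every shape above `β` is saturated
  have hsat : ∀ y : ℝ, β < y → omegaRect ℂ 1 y 1 = y + 1 := by
    intro y hy
    obtain ⟨z, hzZ, hzy⟩ := exists_lt_of_csInf_lt hne (hβ ▸ hy)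
    exact saturated_of_le hzZ.2 hzy.le
  -- no shape in `[1, β)` is saturated
  have hpos : ∀ x : ℝ, 1 ≤ x → x < β → x + 1 < omegaRect ℂ 1 x 1 := by
    intro x hx hxβ
    rcases (add_one_le_omegaRect_one_mid_one ℂ x).lt_or_eq with h | h
    · exact h
    · have h' : β ≤ x := hβ ▸ csInf_le hbdd ⟨hx, h.symm⟩
      exact absurd h' (not_le.2 hxβ)
  -- `β` itself is saturated, by continuity
  have hβsat : omegaRect ℂ 1 β 1 = β + 1 := by
    have hc := profile_continuousAt (b := β) (by linarith)
    have h1 : Tendsto (fun y : ℝ => omegaRect ℂ 1 y 1) (𝓝[>] β) (𝓝 (omegaRect ℂ 1 β 1)) :=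
      hc.tendsto.mono_left nhdsWithin_le_nhds
    have h2 : Tendsto (fun y : ℝ => y + 1) (𝓝[>] β) (𝓝 (β + 1)) :=
      ((continuous_add_const (1 : ℝ)).tendsto β).mono_left nhdsWithin_le_nhds
    have h3 : (fun y : ℝ => omegaRect ℂ 1 y 1) =ᶠ[𝓝[>] β] fun y : ℝ => y + 1 := by
      filter_upwards [self_mem_nhdsWithin] with y hy
      exact hsat y hy
    exact tendsto_nhds_unique (h1.congr' h3) h2
  -- `β > 1` since `ω > 2`
  have hβgt : 1 < β := by
    rcases hβ1.lt_or_eq with h | h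
    · exact h
    · exfalso
      apply hS
      rw [_root_.MatrixMultiplication_iff]
      have h' := hβsat
      rw [← h, omegaRect_one_one_one] at h'
      linarith
  exact ⟨β, hβgt, hβsat, hpos⟩

/-- **Gap case.**  At a saturated `b > 1` with `∂⁻f(b) < 1` the contact is TRANSVERSAL at `b`, with slope
`a = ∂⁻f(b)`. -/
theorem transversalAt_of_leftDeriv_lt_one {b : ℝ} (hb : 1 < b) (hs : omegaRect ℂ 1 b 1 = b + 1)
    (hL : derivWithin (fun y : ℝ => omegaRect ℂ 1 y 1) (Iio b) b < 1) :
    ∃ a : ℝ, a < 1 ∧ (∀ y : ℝ, b ≤ y → omegaRect ℂ 1 y 1 = y + 1) ∧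
      ∀ x : ℝ, 1 ≤ x → x ≤ b → omegaRect ℂ 1 b 1 - a * (b - x) ≤ omegaRect ℂ 1 x 1 := by
  refine ⟨_, hL, fun y hy => saturated_of_le hs hy, fun x hx hxb => ?_⟩
  rcases hxb.lt_or_eq with h | h
  · exact sub_leftDeriv_mul_le (by linarith) (by linarith) h
  · subst h
    simp

/-- ★ **LOCAL DICHOTOMY at a saturated shape.**  At a saturated `b > 1`, `f` is differentiable at `b` iff there
is NO transversal contact at `b`.  (`⇒` is the landed corner lemma `not_differentiableAt_of_transversal`; `⇐`:
no transversal contact forces `∂⁻f(b) = 1` by the gap case, and then `f'(b) = 1` exists.) -/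
theorem differentiableAt_iff_not_transversalAt {b : ℝ} (hb : 1 < b) (hs : omegaRect ℂ 1 b 1 = b + 1) :
    DifferentiableAt ℝ (fun y : ℝ => omegaRect ℂ 1 y 1) b ↔
      ¬ ∃ a : ℝ, a < 1 ∧ (∀ y : ℝ, b ≤ y → omegaRect ℂ 1 y 1 = y + 1) ∧
        ∀ x : ℝ, 1 ≤ x → x ≤ b → omegaRect ℂ 1 b 1 - a * (b - x) ≤ omegaRect ℂ 1 x 1 := by
  constructor
  · rintro hd ⟨a, ha, hr, hl⟩
    exact not_differentiableAt_of_transversal hb ha hr hl hd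
  · intro h
    rcases (leftDeriv_le_one hb hs).lt_or_eq with hlt | heq
    · exact absurd (transversalAt_of_leftDeriv_lt_one hb hs hlt) h
    · exact (differentiableAt_iff_leftDeriv_eq_one hb hs).2 heq

/-- **CONTACT-ANGLE PRICE.**  A transversal contact of slope `a` at `b` costs `(1 − a)(b − 1) ≤ ω − 2`
(evaluate the supporting line at the square shape `x = 1`): far contacts are nearly tangential. -/
theorem contact_angle_price {b a : ℝ} (hb : 1 < b)
    (hright : ∀ y : ℝ, b ≤ y → omegaRect ℂ 1 y 1 = y + 1)
    (hleft : ∀ x : ℝ, 1 ≤ x → x ≤ b → omegaRect ℂ 1 b 1 - a * (b - x) ≤ omegaRect ℂ 1 x 1) :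
    (1 - a) * (b - 1) ≤ omega ℂ - 2 := by
  have h1 := hleft 1 le_rfl hb.le
  rw [hright b le_rfl, omegaRect_one_one_one] at h1
  linarith

/-- In a TANGENTIAL contact the excess vanishes to first order: `f` differentiable at a saturated shape `b`
gives `e(x) = o(x − b)` at `b` (versus `e(x) ≥ (1−a)(b−x)` on `[1,b]` in a transversal one). -/
theorem excess_isLittleO_of_tangential {b : ℝ} (hs : omegaRect ℂ 1 b 1 = b + 1)
    (hd : DifferentiableAt ℝ (fun y : ℝ => omegaRect ℂ 1 y 1) b) :
    (fun x : ℝ => omegaRect ℂ 1 x 1 - (x + 1)) =o[𝓝 b] fun x : ℝ => x - b := by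
  have h := (hasDerivAt_iff_isLittleO).1 (hasDerivAt_one_of_differentiableAt hs hd)
  refine h.congr_left fun x => ?_
  simp only [hs, smul_eq_mul, mul_one]
  ring

/-! ## §3 ★ The contact trichotomy -/

/-- ★ **CONTACT TRICHOTOMY (exhaustion).**  `ω(ℂ) > 2` iff the far-edge profile lies in one of three worlds:
(W1) ROUND — no finite saturation; (W2) TRANSVERSAL — a transversal contact; (W3) TANGENTIAL — a first zero
`β > 1` of the excess at which the profile is differentiable.  (The three are pairwise exclusive, below.) -/
theorem not_mm_iff_round_or_transversal_or_tangential :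
    ¬ _root_.MatrixMultiplication ↔
      (¬ FiniteSaturation) ∨
      (∃ b a : ℝ, 1 < b ∧ a < 1 ∧ (∀ y : ℝ, b ≤ y → omegaRect ℂ 1 y 1 = y + 1) ∧
        ∀ x : ℝ, 1 ≤ x → x ≤ b → omegaRect ℂ 1 b 1 - a * (b - x) ≤ omegaRect ℂ 1 x 1) ∨
      (∃ b : ℝ, 1 < b ∧ omegaRect ℂ 1 b 1 = b + 1 ∧ (∀ x : ℝ, 1 ≤ x → x < b → x + 1 < omegaRect ℂ 1 x 1) ∧
        DifferentiableAt ℝ (fun y : ℝ => omegaRect ℂ 1 y 1) b) := by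
  constructor
  · intro hS
    by_cases hF : FiniteSaturation
    · obtain ⟨b, hb, hs, hfirst⟩ := exists_firstZero hF hS
      by_cases hd : DifferentiableAt ℝ (fun y : ℝ => omegaRect ℂ 1 y 1) b
      · exact Or.inr (Or.inr ⟨b, hb, hs, hfirst, hd⟩)
      · have h := mt (differentiableAt_iff_not_transversalAt hb hs).2 hd
        push Not at h
        obtain ⟨a, ha, hr, hl⟩ := h
        exact Or.inr (Or.inl ⟨b, a, hb, ha, hr, hl⟩)
    · exact Or.inl hF
  · rintro (h | h | ⟨b, hb, _, hfirst, -⟩)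
    · exact fun hS => h (finiteSaturation_of_mm hS)
    · exact not_mm_of_transversal h
    · intro hS
      rw [_root_.MatrixMultiplication_iff] at hS
      have h1 := hfirst 1 le_rfl hb
      rw [omegaRect_one_one_one] at h1
      linarith

/-- Exclusivity (W1)/(W2): a transversal contact is a finite saturation. -/
theorem round_transversal_exclusive (hR : ¬ FiniteSaturation) :
    ¬ ∃ b a : ℝ, 1 < b ∧ a < 1 ∧ (∀ y : ℝ, b ≤ y → omegaRect ℂ 1 y 1 = y + 1) ∧
      ∀ x : ℝ, 1 ≤ x → x ≤ b → omegaRect ℂ 1 b 1 - a * (b - x) ≤ omegaRect ℂ 1 x 1 :=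
  fun h => hR (finiteSaturation_of_transversal h)

/-- Exclusivity (W1)/(W3): a tangential contact is a finite saturation. -/
theorem round_tangential_exclusive (hR : ¬ FiniteSaturation) :
    ¬ ∃ b : ℝ, 1 < b ∧ omegaRect ℂ 1 b 1 = b + 1 ∧ (∀ x : ℝ, 1 ≤ x → x < b → x + 1 < omegaRect ℂ 1 x 1) ∧
      DifferentiableAt ℝ (fun y : ℝ => omegaRect ℂ 1 y 1) b :=
  fun ⟨b, hb, hs, _, _⟩ => hR (finiteSaturation_iff_realSaturation.2 ⟨b, hb, hs⟩)

/-- Exclusivity (W2)/(W3): both contacts sit at the unique first zero, where `f` is differentiable in (W3) and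
not differentiable in (W2). -/
theorem transversal_tangential_exclusive
    (hT : ∃ b a : ℝ, 1 < b ∧ a < 1 ∧ (∀ y : ℝ, b ≤ y → omegaRect ℂ 1 y 1 = y + 1) ∧
      ∀ x : ℝ, 1 ≤ x → x ≤ b → omegaRect ℂ 1 b 1 - a * (b - x) ≤ omegaRect ℂ 1 x 1) :
    ¬ ∃ b : ℝ, 1 < b ∧ omegaRect ℂ 1 b 1 = b + 1 ∧ (∀ x : ℝ, 1 ≤ x → x < b → x + 1 < omegaRect ℂ 1 x 1) ∧
      DifferentiableAt ℝ (fun y : ℝ => omegaRect ℂ 1 y 1) b := by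
  rintro ⟨b', hb', hs', hfirst', hd'⟩
  obtain ⟨b, a, hb, ha, hr, hl⟩ := hT
  have hfz := firstZero_of_transversal ha hr hl
  have e := firstZero_unique hb.le hb'.le hfz ⟨hs', hfirst'⟩
  subst e
  exact not_differentiableAt_of_transversal hb ha hr hl hd'

/-- The three worlds each force `ω > 2` (the tangential one: `e(1) > 0` because `β > 1` is the FIRST zero). -/
theorem not_mm_of_tangential
    (h : ∃ b : ℝ, 1 < b ∧ omegaRect ℂ 1 b 1 = b + 1 ∧ (∀ x : ℝ, 1 ≤ x → x < b → x + 1 < omegaRect ℂ 1 x 1) ∧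
      DifferentiableAt ℝ (fun y : ℝ => omegaRect ℂ 1 y 1) b) :
    ¬ _root_.MatrixMultiplication :=
  not_mm_iff_round_or_transversal_or_tangential.2 (Or.inr (Or.inr h))

end Summit.MatrixMultiplication.MatrixMultiplication.Theorems.FarEdgeDescentContactTrichotomy

end
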